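import Summits.Ventures.PercRepro.ThetaOmegaGraphHitting

/-!
# The graph form of (Ω): the bipartite / odd-cycle dichotomy

Addendum 85 (mine-1, gen 46). In the triangle form, a family `M` of marked sets HITS `F` when every
three distinct slots of `F` have a pairwise meet in `M`; its FREE graph joins two slots whose meet
is outside `M`. The theorem (Ω) of gen 43 (kernel `card_le_omegaCountG_of_bipartite`) says that a
hitting family with a BIPARTITE free graph has at least `|F|` members. This file isolates what is
left of (Ω_Γ):

* `HitsTriples U F M`, `BipartiteFree U F M` — the two notions;
* `card_le_of_bipartiteFree` — (Ω) in the triangle language: a bipartite free graph forces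
  `|F| ≤ |M|`;
* `OmegaOddCycle α` — **Conjecture T⁺**: for `|F| ≥ 4`, a hitting family whose free graph is NOT
  bipartite has at least `|F| + 1` members (census: every tight hitting family at `|F| = 4` on
  ≤ 7 points has a bipartite free graph; at `|F| = 3` non-bipartite tight ones exist);
* `omegaHitting_of_omegaOddCycle` — **the reduction**: T⁺ implies the triangle form of (Ω_Γ),
  hence (Ω_Γ) itself (`omegaGraphSymm_of_omegaOddCycle`): the bipartite case is (Ω), the
  three-member case is `three_le_omegaCountG`, the rest is T⁺.
-/

namespace PercRepro.MSTight

open Finset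

variable {α : Type*} [DecidableEq α]

section Dichotomy

variable {U : Finset α} {F : Finset (Finset α)} {M : Finset (Finset α × Bool)}

/-- `M` hits every triple of distinct slots of `F`: some pairwise slot meet lies in `M`. -/
def HitsTriples (U : Finset α) (F : Finset (Finset α)) (M : Finset (Finset α × Bool)) : Prop :=
  ∀ u v w : Slot α, u.1 ∈ F → v.1 ∈ F → w.1 ∈ F → u ≠ v → u ≠ w → v ≠ w →
    slotMeet U u v ∈ M ∨ slotMeet U u w ∈ M ∨ slotMeet U v w ∈ M

/-- The free graph of `M` on the slots of `F` (two distinct slots are joined when their meet is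
outside `M`) is bipartite: a two-colouring of the slots such that same-coloured distinct slots of
`F` have their meet in `M`. -/
def BipartiteFree (U : Finset α) (F : Finset (Finset α)) (M : Finset (Finset α × Bool)) : Prop :=
  ∃ χ : Slot α → Bool, ∀ u v : Slot α, u.1 ∈ F → v.1 ∈ F → u ≠ v → χ u = χ v →
    slotMeet U u v ∈ M

/-- The graph «the meet lies in `M`» has all its counted sets in `M`. -/
theorem omegaSetG_memMeet_subset :
    omegaSetG (fun u v => slotMeet U u v ∈ M) U F ⊆ M := by
  intro x hx
  obtain ⟨u, v, _, _, _, hr, rfl⟩ := exists_of_mem_omegaSetG hx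
  exact hr

/-- **(Ω) in the triangle language**: a family of marked sets whose free graph on the slots of `F`
is bipartite has at least `|F|` members (`|F| ≥ 3`). -/
theorem card_le_of_bipartiteFree (hF : ∀ s ∈ F, s ⊆ U) (h3 : 3 ≤ F.card)
    (hb : BipartiteFree U F M) : F.card ≤ M.card := by
  obtain ⟨χ, hχ⟩ := hb
  have h := card_le_omegaCountG_of_bipartite (Γ := fun u v => slotMeet U u v ∈ M) hF h3 χ hχ
  rw [← card_omegaSetG] at h
  exact le_trans h (card_le_card omegaSetG_memMeet_subset)

/-- The three-member bound in the triangle language: a family hitting the triples of a family of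
three members has at least three members. -/
theorem three_le_card_of_hitsTriples (hF : ∀ s ∈ F, s ⊆ U) (h3 : F.card = 3)
    (hM : HitsTriples U F M) : 3 ≤ M.card := by
  have hsym : ∀ u v, (fun u v => slotMeet U u v ∈ M) u v → (fun u v => slotMeet U u v ∈ M) v u :=
    fun u v h => by
      show slotMeet U v u ∈ M
      rw [slotMeet_comm]
      exact h
  have hT : SlotTripleRel (fun u v => slotMeet U u v ∈ M) F := by
    intro u v w hu hv hw huv huw hvw
    rcases hM u v w hu hv hw huv huw hvw with h | h | h
    · exact Or.inl h
    · exact Or.inr (Or.inr (Or.inl h))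
    · exact Or.inr (Or.inr (Or.inr (Or.inr (Or.inl h))))
  have h := three_le_omegaCountG (Γ := fun u v => slotMeet U u v ∈ M) hsym hF h3 hT
  rw [← card_omegaSetG] at h
  exact le_trans h (card_le_card omegaSetG_memMeet_subset)

/-- **Conjecture T⁺ (the odd-cycle surcharge)**: for a family of at least four members, a family
of marked sets hitting every triple of slots whose free graph is NOT bipartite has at least
`|F| + 1` members. -/
def OmegaOddCycle (α : Type*) [DecidableEq α] : Prop :=
  ∀ (U : Finset α) (F : Finset (Finset α)) (M : Finset (Finset α × Bool)),
    (∀ s ∈ F, s ⊆ U) → 4 ≤ F.card → HitsTriples U F M → ¬ BipartiteFree U F M →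
      F.card + 1 ≤ M.card

/-- **The reduction**: T⁺ implies the triangle form of (Ω_Γ) — the bipartite case is (Ω), the
three-member case is the three-member theorem, the non-bipartite case with four or more members
is T⁺ (with one to spare). -/
theorem omegaHitting_of_omegaOddCycle (hT : OmegaOddCycle α) : OmegaHitting α := by
  intro U F M hF h3 hM
  by_contra hno
  simp only [not_exists, not_and, not_not] at hno
  have hhit : HitsTriples U F M := by
    intro u v w hu hv hw huv huw hvw
    by_cases h1 : slotMeet U u v ∈ M
    · exact Or.inl h1
    by_cases h2 : slotMeet U u w ∈ M
    · exact Or.inr (Or.inl h2)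
    exact Or.inr (Or.inr (hno u v w hu hv hw huv huw hvw h1 h2))
  rcases lt_or_eq_of_le h3 with h4 | h3'
  · by_cases hb : BipartiteFree U F M
    · exact absurd (card_le_of_bipartiteFree hF h3 hb) (not_le.2 hM)
    · have := hT U F M hF h4 hhit hb
      omega
  · have := three_le_card_of_hitsTriples hF h3'.symm hhit
    omega

/-- T⁺ implies (Ω_Γ). -/
theorem omegaGraphSymm_of_omegaOddCycle (hT : OmegaOddCycle α) : OmegaGraphSymm α :=
  omegaGraphSymm_of_omegaHitting (omegaHitting_of_omegaOddCycle hT)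

end Dichotomy

end PercRepro.MSTight
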